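import Summits.QuantumFields.YangMills.Theorems.BalabanLadderUVSeamRecCeilingsDLRPeeling
import HarnessLib

/-!
# Crux `UVSeamRec` (stmt-QuantumFields-20043), lane B: the TRUE LINK SUPPORT of Bałaban's block-averaged plaquette field —
# locality of the `k`-fold (0.4) averaging on a Bałaban torus, `IsCylinder blockField (b^k y + [0,4b^k)⁴)`, and the collar
# cube of the (UCR) hypothesis for every odd block size `b` as soon as `m ≥ 3`

Helper file (`--supports stmt-QuantumFields-20043`) of the width-lever seat `ym-20043-ceilings-p2` (lane B, gen 7); sequel of
`…CeilingsDLRPeeling` (g6: the peeling engine and the FORMAL link support of `blockField`, namely the whole chart box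
`b^k(y − (b−1)) + [0, 2b^{k+1})⁴`, whence the collar condition `m ≥ b` of the (UCR) chain).

THE POINT.  The one-box hypothesis (UCR) of the v8(β-cl-UCR) candidate (LEAD 20043 g9) asks a cube-kernel bound in the collar cube of
side `(2m+1)b^k` with `𝔟.b ≤ m ≤ 7`: the cap `m ≤ 7` makes the collar cube fit in the (RM) torus at the top family-shell level, the floor
`m ≥ b` makes the formal support of the block-field indicator sit inside the collar cube.  Together they force Bałaban's block size
`b ≤ 7`, below the printed range «L > 11» of [Balaban1987RG1] p. 251 (`Setup.Params`, DIVERGENCE F1) — an artefact: the chart box is a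
typing convenience, the block average is LOCAL.  §1 kernel-checks the locality of `Averaging.iter` on any Bałaban torus (any family of
one-step averagings, any gauge group): the level-`k` bond variable at `C` depends only on the fine bond variables whose initial points carry
labels in `b^k·n(C₋) + [0, 3b^k)^d` (`iter_local_box`; induction on `Averaging.local_dep` with `Site.val_blockOf`), and the level-`k`
plaquette variable at `p` only on labels in `b^k·n(p) + [0, 4b^k)^d` (`plaqHol_iter_local_box`).  §2 pulls this back along tempered-d1's
chart: `blockField 𝔟 k y μ ν` and the indicator of `largeFieldEvent 𝔟 ε (k,y,μ,ν)` are cylinder observables on the box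
`b^k y + [0, 4b^k)⁴` of `ℤ⁴` (base points), for EVERY odd `b > 1` (`isCylinder_blockField_local`,
`isCylinder_indicator_largeFieldEvent_local`), and that box sits in the closed window of the collar cube of corner `b^k(y − m)` and side
`(2m+1)b^k` as soon as `m ≥ 3` (`localBox_window`).  The sequel `…CeilingsDLRPeelingSmallCollar` re-runs g6's (UCR) ⇒ hWCL ⇒ (RM) chain
with `3 ≤ m ≤ 7` for every block size.

HONEST FRAMING.  Bookkeeping of a DEFINITION (finite-range dependence of the block averaging, recorded «in prose only» in
`…UVSeamRecPolymerData`); it removes an artificial constraint from a CONDITIONAL chain whose inputs (split-cl), (GD), (UCR) stay OPEN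
renormalisation-group statements; nothing of E0′; not a gap, not Clay.  References: T. Bałaban, Commun. Math. Phys. 98 (1985) 17–51, p. 19
(locality of the averaging); 109 (1987) 249–301, (0.4) p. 253; folklore.
-/

set_option autoImplicit false

noncomputable section

open Finset
open Literature.MathematicalPhysics.QuantumFieldTheory (GaugeConfig)
open Literature.MathematicalPhysics.QuantumFieldTheory.Balaban1983to89
open Literature.MathematicalPhysics.QuantumLattice (LGConfig IsCylinder)

namespace Summit.QuantumFields.YangMills.Cruxes.UVSeamRec.BlockFieldLocality

open Summit.QuantumFields.YangMills.Cruxes.UVSeamRec.PolymerData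

/-! ## §1 Locality of the `k`-fold averaging on a Bałaban torus -/

section Torus

variable {P : Params} {G : Type*} [GaugeGroup G]

omit [GaugeGroup G] in
/-- `blockOf x = y` pins the integer label of `x` to the `L`-block of the label of `y`: `L·n(y) ≤ n(x) < L·(n(y)+1)` (standing
range). [folklore] -/
theorem val_bounds_of_blockOf_eq {j : ℕ} (hj : j + 1 ≤ P.m + P.K) {x : Site P j} {y : Site P (j + 1)}
    (h : blockOf x = y) (μ : Fin P.d) :
    P.L * (y μ).val ≤ (x μ).val ∧ (x μ).val < P.L * ((y μ).val + 1) := by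
  have hv : (x μ).val / P.L = (y μ).val := by rw [← Site.val_blockOf hj x μ, h]
  refine ⟨?_, ?_⟩
  · rw [← hv]; exact Nat.mul_div_le _ _
  · rw [← hv]; exact Nat.lt_mul_div_succ _ P.L_pos

omit [GaugeGroup G] in
/-- The label of `x + e_μ` is the label of `x` plus `1` in direction `μ` when no reduction modulo the site count occurs. [folklore] -/
theorem val_shift_of_lt {j : ℕ} (x : Site P j) (μ ν : Fin P.d) (hx : (x μ).val + 1 < P.sitesPerDir j) :
    ((x.shift μ) ν).val = (x ν).val + (if ν = μ then 1 else 0) := by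
  unfold Site.shift
  by_cases hν : ν = μ
  · subst hν
    rw [Function.update_self, if_pos rfl, ZMod.val_add, ZMod.val_one, Nat.mod_eq_of_lt hx]
  · rw [Function.update_of_ne hν, if_neg hν, add_zero]

omit [GaugeGroup G] in
/-- Arithmetic of one averaging step (box inclusion): labels `w` of the block of `v` or of `v+1` (`L·v ≤ w`, `w + 1 ≤ L(v+2)`) have their
scale-`a` boxes `a·w + [0,3a)` inside the scale-`aL` box `aL·v + [0, 3aL)` (`L ≥ 2`). [folklore] -/
theorem box_step {L a v w t : ℕ} (hL : 2 ≤ L) (hvw : L * v ≤ w) (hwv : w + 1 ≤ L * (v + 2))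
    (ht : a * w ≤ t ∧ t < a * (w + 3)) : a * L * v ≤ t ∧ t < a * L * (v + 3) := by
  refine ⟨?_, ?_⟩
  · calc a * L * v = a * (L * v) := by ring
      _ ≤ a * w := Nat.mul_le_mul_left _ hvw
      _ ≤ t := ht.1
  · have h1 : w + 3 ≤ L * (v + 3) := by nlinarith
    calc t < a * (w + 3) := ht.2
      _ ≤ a * (L * (v + 3)) := Nat.mul_le_mul_left _ h1
      _ = a * L * (v + 3) := by ring

omit [GaugeGroup G] in
/-- Arithmetic of one averaging step (room): `w + 1 ≤ L(v+2)` and `v + 3 ≤ S` give `w + 3 ≤ S·L` (`L ≥ 2`). [folklore] -/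
theorem room_step {L v w S : ℕ} (hL : 2 ≤ L) (hwv : w + 1 ≤ L * (v + 2)) (hvS : v + 3 ≤ S) : w + 3 ≤ S * L := by
  have h1 : L * (v + 3) ≤ L * S := Nat.mul_le_mul_left _ hvS
  nlinarith

/-- **LOCALITY OF THE `k`-FOLD BLOCK AVERAGING ON A BAŁABAN TORUS.**  For ANY family of one-step averagings `av` (interface
`Setup.Averaging`: locality `local_dep` in the standing range) and `k ≤ m + K`, the `k`-fold average `Ū^k = Averaging.iter av k U` at a
level-`k` bond `C` whose initial point keeps three sites of room below the site count (`n(C₋)_μ + 3 ≤ sitesPerDir k`, so no step wraps)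
depends only on the fine bond variables `U(b)`, `b₋` with labels in the box `L^k·n(C₋) + [0, 3L^k)^d`.  Induction on `k`: one step reads
the bonds issuing from `B(C₋) ∪ B(C₊)` (`Averaging.local_dep`), whose labels lie in `L·n(C₋) + [0, 2L)` (`Site.val_blockOf`), and
`L^k(2L) + 3L^k ≤ 3L^{k+1}`. [cite: Balaban1985Averaging, p.19] -/
theorem iter_local_box (av : ∀ j, Averaging P j G) :
    ∀ (k : ℕ), k ≤ P.m + P.K → ∀ (C : PBond P k), (∀ μ, (C.src μ).val + 3 ≤ P.sitesPerDir k) →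
      ∀ (U U' : GaugeField P 0 G),
        (∀ b : PBond P 0, (∀ μ, P.L ^ k * (C.src μ).val ≤ (b.src μ).val ∧
          (b.src μ).val < P.L ^ k * ((C.src μ).val + 3)) → U b = U' b) →
        Averaging.iter av k U C = Averaging.iter av k U' C
  | 0, _, C, _, U, U', h => h C fun μ => ⟨by rw [pow_zero, one_mul], by rw [pow_zero, one_mul]; omega⟩
  | k + 1, hk, C, hroom, U, U', h => by
    show (av k).avg (Averaging.iter av k U) C = (av k).avg (Averaging.iter av k U') C
    refine (av k).local_dep hk _ _ C fun b₁ hb₁ => ?_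
    have hS : P.sitesPerDir k = P.sitesPerDir (k + 1) * P.L := P.sitesPerDir_eq_mul_succ hk
    have hL : 2 ≤ P.L := P.hL.2
    -- labels of `b₁₋`: `L·v ≤ w` and `w + 1 ≤ L·(v + 2)`
    have hw : ∀ μ, P.L * (C.src μ).val ≤ (b₁.src μ).val ∧ (b₁.src μ).val + 1 ≤ P.L * ((C.src μ).val + 2) := by
      intro μ
      rcases hb₁ with h₁ | h₁
      · have h2 := val_bounds_of_blockOf_eq (P := P) hk h₁ μ
        refine ⟨h2.1, ?_⟩
        calc (b₁.src μ).val + 1 ≤ P.L * ((C.src μ).val + 1) := h2.2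
          _ ≤ P.L * ((C.src μ).val + 2) := Nat.mul_le_mul_left _ (by omega)
      · have h2 := val_bounds_of_blockOf_eq (P := P) hk h₁ μ
        have ht : ((C.tgt) μ).val = (C.src μ).val + (if μ = C.dir then 1 else 0) :=
          val_shift_of_lt (P := P) C.src C.dir μ (by have := hroom C.dir; omega)
        rw [ht] at h2
        have hδ : (if μ = C.dir then 1 else 0) ≤ 1 := by split_ifs <;> omega
        refine ⟨?_, ?_⟩
        · calc P.L * (C.src μ).val ≤ P.L * ((C.src μ).val + if μ = C.dir then 1 else 0) :=
              Nat.mul_le_mul_left _ (Nat.le_add_right _ _)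
            _ ≤ (b₁.src μ).val := h2.1
        · calc (b₁.src μ).val + 1 ≤ P.L * (((C.src μ).val + if μ = C.dir then 1 else 0) + 1) := h2.2
            _ ≤ P.L * ((C.src μ).val + 2) := Nat.mul_le_mul_left _ (by omega)
    refine iter_local_box av k (by omega) b₁ (fun μ => ?_) U U' (fun b hb => h b fun μ => ?_)
    · exact (room_step hL (hw μ).2 (hroom μ)).trans hS.ge
    · have := box_step (a := P.L ^ k) hL (hw μ).1 (hw μ).2 (hb μ)
      rw [pow_succ]
      exact this

/-- **Locality of the `k`-fold block-averaged PLAQUETTE variable**: `Ū^k(∂p)` depends only on the fine bond variables with initial labels in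
`L^k·n(p) + [0, 4L^k)^d` (room `n(p)_μ + 4 ≤ sitesPerDir k`). [cite: Balaban1985Averaging, p.19] -/
theorem plaqHol_iter_local_box (av : ∀ j, Averaging P j G) (k : ℕ) (hk : k ≤ P.m + P.K) (p : Plaq P k)
    (hroom : ∀ μ, (p.src μ).val + 4 ≤ P.sitesPerDir k) (U U' : GaugeField P 0 G)
    (h : ∀ b : PBond P 0, (∀ μ, P.L ^ k * (p.src μ).val ≤ (b.src μ).val ∧
      (b.src μ).val < P.L ^ k * ((p.src μ).val + 4)) → U b = U' b) :
    GaugeField.plaqHol (Averaging.iter av k U) p = GaugeField.plaqHol (Averaging.iter av k U') p := by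
  have hL : 2 ≤ P.L := P.hL.2
  have ha : 1 ≤ P.L ^ k := Nat.one_le_pow _ _ P.L_pos
  -- the four bonds of `∂p`: sources `x`, `x + e_μ`, `x + e_ν`, `x`
  have key : ∀ (C : PBond P k), (∀ κ, (p.src κ).val ≤ (C.src κ).val ∧ (C.src κ).val ≤ (p.src κ).val + 1) →
      Averaging.iter av k U C = Averaging.iter av k U' C := by
    intro C hC
    refine iter_local_box av k hk C (fun κ => by have := hC κ; have := hroom κ; omega) U U' fun b hb => h b fun κ => ?_
    have h1 := hb κ
    have h2 := hC κ
    refine ⟨?_, ?_⟩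
    · calc P.L ^ k * (p.src κ).val ≤ P.L ^ k * (C.src κ).val := Nat.mul_le_mul_left _ h2.1
        _ ≤ (b.src κ).val := h1.1
    · calc (b.src κ).val < P.L ^ k * ((C.src κ).val + 3) := h1.2
        _ ≤ P.L ^ k * ((p.src κ).val + 4) := Nat.mul_le_mul_left _ (by omega)
  have hsh : ∀ (μ κ : Fin P.d), ((p.src.shift μ) κ).val = (p.src κ).val + (if κ = μ then 1 else 0) := fun μ κ =>
    val_shift_of_lt (P := P) p.src μ κ (by have := hroom μ; omega)
  have hx : ∀ κ, (p.src κ).val ≤ (p.src κ).val ∧ (p.src κ).val ≤ (p.src κ).val + 1 := fun κ => ⟨le_rfl, Nat.le_succ _⟩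
  have hxs : ∀ (μ κ : Fin P.d), (p.src κ).val ≤ ((p.src.shift μ) κ).val ∧ ((p.src.shift μ) κ).val ≤ (p.src κ).val + 1 := by
    intro μ κ
    rw [hsh μ κ]
    constructor <;> split_ifs <;> omega
  unfold GaugeField.plaqHol
  rw [key ⟨p.src, p.μ⟩ hx, key ⟨p.src.shift p.μ, p.ν⟩ (hxs p.μ), key ⟨p.src.shift p.ν, p.μ⟩ (hxs p.ν), key ⟨p.src, p.ν⟩ hx]

end Torus

/-! ## §2 The true link support of `blockField` and of N20's large-field event on `ℤ⁴`; the collar cube for `m ≥ 3` -/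

section Chart

variable {N : ℕ} [NeZero N]

omit [NeZero N] in
/-- A Bałaban block size is at least `3` (odd and `> 1`). [folklore] -/
theorem three_le_b (𝔟 : BlockSize) : 3 ≤ 𝔟.b := by
  obtain ⟨⟨r, hr⟩, h1⟩ := 𝔟.hb
  omega

omit [NeZero N] in
/-- The base point of the central `k`-plaquette of the chart carries the label `b − 1` in every direction (no reduction modulo the site
count `2b` of `T^{(k)}`). [folklore] -/
theorem val_centralPlaq_src (𝔟 : BlockSize) (k : ℕ) (μ ν : Fin 4) (h : μ < ν) (i : Fin 4) :
    ((centralPlaq 𝔟 k μ ν h).src i).val = 𝔟.b - 1 := by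
  show (((𝔟.b - 1 : ℕ) : ZMod ((chartParams 𝔟 k).sitesPerDir k))).val = 𝔟.b - 1
  rw [ZMod.val_natCast, Nat.mod_eq_of_lt]
  rw [chartParams_sitesPerDir, show 1 + k - k = 1 by omega, pow_one]
  have := 𝔟.hb.2
  omega

omit [NeZero N] in
/-- Room of the central `k`-plaquette in the chart torus `T^{(k)}` (`2b` sites per direction): `(b − 1) + 4 ≤ 2b`, i.e. `b ≥ 3`. [folklore] -/
theorem centralPlaq_room (𝔟 : BlockSize) (k : ℕ) (μ ν : Fin 4) (h : μ < ν) (i : Fin 4) :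
    ((centralPlaq 𝔟 k μ ν h).src i).val + 4 ≤ (chartParams 𝔟 k).sitesPerDir k := by
  rw [val_centralPlaq_src, chartParams_sitesPerDir, show 1 + k - k = 1 by omega, pow_one]
  have := three_le_b 𝔟
  omega

/-- **THE TRUE LINK SUPPORT OF THE BLOCK-AVERAGED PLAQUETTE FIELD.**  For EVERY odd block size `b > 1`, every level `k`, block index
`y ∈ ℤ⁴` and orientation `μ < ν`, tempered-d1's `blockField 𝔟 k y μ ν` (`= 1 − reTr Ū^k(∂p)` read through the chart centred at the block
`b^k y + [0,b^k)⁴`) is a cylinder observable on the box `b^k y + [0, 4b^k)⁴` of BASE POINTS — four blocks forward of the anchor in every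
direction — instead of the formal chart box `b^k(y − (b−1)) + [0, 2b^{k+1})⁴` of `DLRPeeling.isCylinder_blockField`.  Proof: §1's locality of
the `k`-fold averaging at the central `k`-plaquette of the chart torus (labels `(b−1)b^k + [0, 4b^k)`, no wrap since `b ≥ 3`), read back
through `chart`/`ofConfig`. [cite: Balaban1985Averaging, p.19] -/
theorem isCylinder_blockField_local (𝔟 : BlockSize) (k : ℕ) (y : Fin 4 → ℤ) (μ ν : Fin 4) (h : μ < ν) :
    IsCylinder (blockField (N := N) 𝔟 k y μ ν h)
      ((Fintype.piFinset fun i => Finset.Ico ((𝔟.b : ℤ) ^ k * y i) ((𝔟.b : ℤ) ^ k * y i + 4 * (𝔟.b : ℤ) ^ k)) ×ˢ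
        (Finset.univ : Finset (Fin 4))) := by
  intro η η' hηη'
  have hk : k ≤ (chartParams 𝔟 k).m + (chartParams 𝔟 k).K := by show k ≤ 1 + k; omega
  have key := plaqHol_iter_local_box (P := chartParams 𝔟 k) (G := Matrix.specialUnitaryGroup (Fin N) ℂ)
    (fun _ => BlockAveraging.blockAvg (ExpMeanLog.expMeanLogSU (n := Fin N))) k hk (centralPlaq 𝔟 k μ ν h)
    (centralPlaq_room 𝔟 k μ ν h) (ofConfig (P := chartParams 𝔟 k) (j := 0) (chart (chartOrigin 𝔟 k y) η))
    (ofConfig (P := chartParams 𝔟 k) (j := 0) (chart (chartOrigin 𝔟 k y) η')) ?_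
  · unfold blockField blockAvgIter
    rw [key]
  intro b hb
  simp only [ofConfig_apply, chart_apply]
  refine hηη' _ (Finset.mem_coe.2 (Finset.mem_product.2 ⟨Fintype.mem_piFinset.2 fun i => Finset.mem_Ico.2 ?_,
    Finset.mem_univ _⟩))
  have hbi := hb i
  rw [val_centralPlaq_src] at hbi
  change 𝔟.b ^ k * (𝔟.b - 1) ≤ (b.src i).val ∧ (b.src i).val < 𝔟.b ^ k * (𝔟.b - 1 + 4) at hbi
  have h1 : 1 ≤ 𝔟.b := 𝔟.one_le
  have hsub : ((𝔟.b - 1 : ℕ) : ℤ) = (𝔟.b : ℤ) - 1 := by omega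
  have hlo : ((𝔟.b : ℤ)) ^ k * ((𝔟.b - 1 : ℕ) : ℤ) ≤ ((b.src i).val : ℤ) := by exact_mod_cast hbi.1
  have hhi : ((b.src i).val : ℤ) < ((𝔟.b : ℤ)) ^ k * (((𝔟.b - 1 : ℕ) : ℤ) + 4) := by exact_mod_cast hbi.2
  rw [hsub] at hlo hhi
  have e1 : chartOrigin 𝔟 k y i = (𝔟.b : ℤ) ^ k * y i - (𝔟.b : ℤ) ^ k * ((𝔟.b : ℤ) - 1) := by
    simp only [chartOrigin]; ring
  have e2 : ((𝔟.b : ℤ)) ^ k * (((𝔟.b : ℤ) - 1) + 4) = (𝔟.b : ℤ) ^ k * ((𝔟.b : ℤ) - 1) + 4 * (𝔟.b : ℤ) ^ k := by ring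
  rw [e2] at hhi
  simp only
  rw [e1]
  constructor <;> linarith

/-- **The true link support of N20's large-field event**: the indicator of `largeFieldEvent 𝔟 ε γ` is a cylinder observable on the box
`b^k y + [0, 4b^k)⁴` of base points (`γ = (k, y, μ<ν)`), for every odd block size. [folklore] -/
theorem isCylinder_indicator_largeFieldEvent_local (𝔟 : BlockSize) (ε : ℝ) (γ : Polymer) :
    IsCylinder ((largeFieldEvent (N := N) 𝔟 ε γ).indicator fun _ => (1 : ℝ))
      ((Fintype.piFinset fun i => Finset.Ico ((𝔟.b : ℤ) ^ γ.k * γ.y i) ((𝔟.b : ℤ) ^ γ.k * γ.y i + 4 * (𝔟.b : ℤ) ^ γ.k)) ×ˢ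
        (Finset.univ : Finset (Fin 4))) := by
  classical
  intro η η' hηη'
  have hb := isCylinder_blockField_local (N := N) 𝔟 γ.k γ.y γ.μ γ.ν γ.hμν hηη'
  simp only [Set.indicator_apply, largeFieldEvent, Set.mem_setOf_eq, hb]

omit [NeZero N] in
/-- **The collar cube for `m ≥ 3`, every block size.**  The true support box `b^k y + [0,4b^k)⁴` of a level-`k` block-plaquette at `y` sits
in the closed window of the collar cube of corner `b^k(y − m)` and side `(2m+1)b^k` as soon as `m ≥ 3` (base points `e`:
`b^k(y_j − m) ≤ e_j ≤ b^k(y_j − m) + (2m+1)b^k`) — replacing the condition `m ≥ b` of `DLRPeeling.chartBox_window`. [folklore] -/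
theorem localBox_window (𝔟 : BlockSize) (m : ℕ) (hm : 3 ≤ m) (k : ℕ) (y : Fin 4 → ℤ)
    {e : Literature.MathematicalPhysics.QuantumLattice.ZdEdge 4}
    (he : e ∈ (Fintype.piFinset fun i => Finset.Ico ((𝔟.b : ℤ) ^ k * y i) ((𝔟.b : ℤ) ^ k * y i + 4 * (𝔟.b : ℤ) ^ k)) ×ˢ
      (Finset.univ : Finset (Fin 4))) (j : Fin 4) :
    (𝔟.b : ℤ) ^ k * (y j - m) ≤ e.1 j ∧ e.1 j ≤ (𝔟.b : ℤ) ^ k * (y j - m) + ((2 * m + 1) * 𝔟.b ^ k : ℕ) := by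
  have he' := Finset.mem_Ico.1 (Fintype.mem_piFinset.1 (Finset.mem_product.1 he).1 j)
  have hbk : (1 : ℤ) ≤ (𝔟.b : ℤ) ^ k := 𝔟.one_le_pow k
  have hm' : (3 : ℤ) ≤ m := by exact_mod_cast hm
  have e1 : (𝔟.b : ℤ) ^ k * (y j - m) = (𝔟.b : ℤ) ^ k * y j - (m : ℤ) * (𝔟.b : ℤ) ^ k := by ring
  have hprod : 0 ≤ ((m : ℤ) - 3) * (𝔟.b : ℤ) ^ k := mul_nonneg (by linarith) (by linarith)
  push_cast
  rw [e1]
  constructor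
  · nlinarith [he'.1]
  · nlinarith [he'.2]

end Chart

end Summit.QuantumFields.YangMills.Cruxes.UVSeamRec.BlockFieldLocality

end
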